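import Summits.ABC.IUTFork.Cor312NaiveProvPinnedVolumes
import Summits.ABC.IUTFork.Cor312PinnedOperators
import Summits.ABC.IUTFork.Cor312PinnedRegionsThreePins
import HarnessLib

/-!
# The PINNED naive model over ANY index skeleton, IV: the region OPERATOR reading each bad place's datum, the
# q-pilot's Kummer datum, and the THREE PINS

Record-only file (D-0012) of the abc-iut cell (D-0067 adjudication, ADJUDICATION-SPEC §2 (G-PINNED)/(G3″);
support piece «G-NV-PROV-PINNED» = PR-2 × PROVENANCE, seat abc-iut-w4-d026 gen 3); TAKES NO SIDE on [IUTchIII]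
Cor. 3.12; introduces NO `Prop` fact (two pieces of MODEL DATA: the operator and the Kummer datum).  Part IV of
five (I Shells · II Thm311 · III Setting + IIIb Volumes · IV Operators · V Witness).  abc-iut-w4-d101's PR-2 (`Cor312PinnedOperators` p419465 / `Cor312PinnedCountermodel` p419720) instantiates
abc-iut-w5-d230's PINS of the Corollary's own statement — (hρ)+(pΘ) `Cor312Vol.ThetaPinned`, (pq′) `QPinned`
(p417551, kurims `paper:url-4b091feeb646` p. 173 l. 46 – p. 174 l. 11) and the third pin (pL) `LinkPinned` /
`PinnedRegions3` (p418935; Step (xi-a) p. 181 l. 33–44) — over the one-place `toyIndex` with the operator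
`orbitRegion Ψ j := Ψ_j·𝒪` read through w4-d101's `line : Packet ≃ ℚ`.  Over an ARBITRARY index skeleton `T` a
rational place `v_ℚ` carries SEVERAL places `v | v_ℚ`, several of them bad, and the packet is a genuine tensor
product; this file supplies the index-generic operator and proves the three pins for Part III's `pinnedSetting`:
* `orbitRegion p Ψ j v_ℚ` — at `j ∈ 𝔽_l^⋆` and `v_ℚ` under a bad place: the union over the bad places `v | v_ℚ` of
  the orbits `ψ_j·𝒪` of the integral structure `B_0 = 𝒪` under the `j`-components of the elements `ψ ∈ Ψ_v`, each
  READ AT ITS OWN SUMMAND through Part I's bad-place coordinate `bcoord v j` (Thm. 3.11 (i) (b) "equipped with a(n)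
  [multiplicative] action on `∏_j 𝓘^ℚ(…)`", p. 154); at the zero label and at the rational places under no bad
  place (no component / no datum) the integral structure `𝒪`.  PROVED: EQUIVARIANT under the whole group
  ⟨(Ind1) ∪ (Ind2)⟩ (= hypothesis (hρ); Part I `actsBySignsAll_of_mem_closure`), NOT constant (`∅ ↦ ∅`), and on
  the model's splitting monoids `Ψ_v = {(±θ_{v,j})_j}` (one-factor theta vectors, coordinate `q^{j²}`) it returns
  `B_{j²} = q^{j²}·𝒪` under every bad place (`orbitRegion_Psi`);
* `qVec p e v j` / `kummerOfExp Q` / `qDatum` — the HONEST bad-place Kummer datum of a q-pilot datum `Q` (w4-d101's,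
  index-generic): at each bad `v` the sign-translates `(±q^e_{v,j})_j` of the tuple of `q`-VECTORS — the value `q^e`,
  `e :=` the exponent READ OFF `Q.q v`, carried by the `α = j` factor on the summand `v` exactly as the theta values are
  (a finite subset of the product of the SUB-packets at `v`, bad-place coordinates `±q^e`); for the setting's own datum
  (`q_v = gen`, `e = 1`) the operator returns `B_1 = q·𝒪` (`orbitRegion_qDatum`);
* THE PINS HOLD: `pinnedSetting_thetaPinned` ((hρ) ∧ (pΘ): at EVERY `(m, j, v_ℚ)` the Kummer image of the Θ-pilot
  object IS `orbitRegion (frobΨ m)`), `pinnedSetting_qPinned` ((pq′): the image of the q-pilot object IS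
  `orbitRegion qDatum`), `pinnedSetting_pinnedRegions`, and with Part III's contentful object-level pilot law (pL)
  `pinnedSetting_pinnedRegions3`.
The failure of Reading R3 / GapA″ / GapA3 / GapH3 / the residual `PilotKummerIndRelated`, and the packaged
countermodel at the provenance level of every initial Θ-datum, are the proof-only Part V.  HONEST SCOPE: interface +
provenance level; regions are cylinders along one packet coordinate per bad place; no judgement on print.
[claim: Mochizuki2012, status: disputed] [cite: ScholzeStix2018, §2.2 pp. 9–10]
-/

noncomputable section

open Set

namespace Summit.ABC

namespace IUTFork

namespace Cor312Vol

namespace NaiveProv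

open Thm311 Cor312 Cor312.IdentifiedNonVacuity Literature.IUT.LogThetaLattice

variable {T : ThetaIndex} (p : ℕ)

/-! ## D1. Sign-scaling inside the integral structure; the coordinate of the all-ones tensor -/

/-- `coordAt (1 ⊗ ⋯ ⊗ 1) = 1` at every base point. [folklore] -/
theorem coordAt_onePt (j : T.Label) (vQ : T.VQ) (w : T.Fibre vQ) : coordAt j vQ w (onePt j vQ) = 1 := by
  unfold onePt; rw [coordAt_tprod]; exact Finset.prod_const_one

/-- Scaling by a sign keeps an element of the integral structure `B_0` inside it (and in every cylinder). [folklore] -/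
theorem smul_mem_pBall_of_abs_eq_one {s : ℚ} (hs : |s| = 1) {j : T.Label} {vQ : T.VQ} {k : ℤ}
    {u : (signShells T).Packet j vQ} (hu : u ∈ pBall p j vQ k) : s • u ∈ pBall p j vQ k := by
  show coord j vQ (s • u) = 0 ∨ k ≤ padicValRat p (coord j vQ (s • u))
  rw [map_smul, smul_eq_mul, NaiveWitness.sign_mul_mem_pBall_iff p hs k]
  exact hu

/-! ## D2. The monoid-to-region operator over the index skeleton -/

open scoped Classical in
/-- **The MONOID-TO-REGION OPERATOR** `Ψ ↦ Ψ_j·𝒪` over the index skeleton `T` (module docstring; w4-d101's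
`orbitRegion`, index-generic): at a label `j ∈ 𝔽_l^⋆` and a rational place `v_ℚ` under a bad place, the union over
the bad places `v | v_ℚ` of the orbits of `B_0 = 𝒪` under the `j`-components of the elements of `Ψ_v`, read at the
summand `v` itself through `bcoord v j`; at the zero label (no component) and under no bad place (no datum) the
integral structure `𝒪`. [claim: Mochizuki2012, status: disputed] -/
def orbitRegion (Ψ : ∀ v : T.V, v ∈ T.Vbad → Set ((signShells T).StarPacket v)) (j : T.Label) (vQ : T.VQ) :
    Set ((signShells T).Packet j vQ) :=
  if h : j ≠ 0 ∧ HasBad vQ then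
    {x | ∃ (v : T.V) (hv : v ∈ T.Vbad) (_ : T.over v = vQ), ∃ ψ ∈ Ψ v hv, ∃ u ∈ pBall p j vQ 0,
      coord j vQ x = bcoord v ⟨j, h.1⟩ ψ * coord j vQ u}
  else pBall p j vQ 0

/-- At the zero label the operator returns `𝒪`. [folklore] -/
theorem orbitRegion_zero (Ψ : ∀ v : T.V, v ∈ T.Vbad → Set ((signShells T).StarPacket v)) (vQ : T.VQ) :
    orbitRegion p Ψ 0 vQ = pBall p 0 vQ 0 := by
  classical
  unfold orbitRegion; rw [dif_neg fun h => h.1 rfl]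

/-- Under no bad place the operator returns `𝒪`. [folklore] -/
theorem orbitRegion_of_not_hasBad (Ψ : ∀ v : T.V, v ∈ T.Vbad → Set ((signShells T).StarPacket v)) (j : T.Label)
    {vQ : T.VQ} (hvQ : ¬ HasBad vQ) : orbitRegion p Ψ j vQ = pBall p j vQ 0 := by
  classical
  unfold orbitRegion; rw [dif_neg fun h => hvQ h.2]

/-- The operator at a nonzero label under a bad place, unfolded. [folklore] -/
theorem orbitRegion_of (Ψ : ∀ v : T.V, v ∈ T.Vbad → Set ((signShells T).StarPacket v)) {j : T.Label} (hj : j ≠ 0)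
    {vQ : T.VQ} (hvQ : HasBad vQ) :
    orbitRegion p Ψ j vQ =
      {x | ∃ (v : T.V) (hv : v ∈ T.Vbad) (_ : T.over v = vQ), ∃ ψ ∈ Ψ v hv, ∃ u ∈ pBall p j vQ 0,
        coord j vQ x = bcoord v ⟨j, hj⟩ ψ * coord j vQ u} := by
  classical
  unfold orbitRegion; rw [dif_pos ⟨hj, hvQ⟩]

/-- At a nonzero label under a bad place the EMPTY monoid determines the EMPTY region — the operator is not a
constant. [folklore] -/
theorem orbitRegion_empty {j : T.Label} (hj : j ≠ 0) {vQ : T.VQ} (hvQ : HasBad vQ) :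
    orbitRegion p (fun _ _ => ∅) j vQ = ∅ := by
  rw [orbitRegion_of p _ hj hvQ]
  ext x
  simp

/-- **EQUIVARIANCE (hρ) under the whole group ⟨(Ind1) ∪ (Ind2)⟩** (Thm. 3.11 (i) "functorial with respect to
isomorphisms of processions", p. 154): transporting the monoid by `Φ` transports the region by `Φ` — every such `Φ`
multiplies the coordinate of the packet AND the bad-place coordinates of the data by signs (Part I
`actsBySignsAll_of_mem_closure`), and the integral structure is sign-stable. [folklore] -/
theorem orbitRegion_equivariant {Φ : (signShells T).PacketAut}
    (hΦ : Φ ∈ Subgroup.closure ((signShells T).Ind1Family ∪ (signShells T).Ind2Family))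
    (Ψ : ∀ v : T.V, v ∈ T.Vbad → Set ((signShells T).StarPacket v)) (j : T.Label) (vQ : T.VQ) :
    orbitRegion p (fun v hv => (signShells T).starAut Φ v '' Ψ v hv) j vQ = Φ j vQ '' orbitRegion p Ψ j vQ := by
  classical
  have hs := actsBySignsAll_of_mem_closure hΦ
  by_cases h : j ≠ 0 ∧ HasBad vQ
  · rw [orbitRegion_of p _ h.1 h.2, orbitRegion_of p _ h.1 h.2]
    obtain ⟨ε, hε, hΦε⟩ := hs.actsBySigns.sign j vQ
    have hεε : ε * ε = 1 := mul_self_of_abs_eq_one hε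
    have hsymm : ∀ x : (signShells T).Packet j vQ, coord j vQ ((Φ j vQ).symm x) = ε * coord j vQ x := fun x => by
      have h1 := hΦε ((Φ j vQ).symm x)
      rw [LinearEquiv.apply_symm_apply] at h1
      rw [h1, ← mul_assoc, hεε, one_mul]
    ext x
    constructor
    · rintro ⟨v, hv, hover, _, ⟨ψ, hψ, rfl⟩, u, hu, hx⟩
      obtain ⟨δ, hδ, hδv⟩ := bcoord_starAut hs v ⟨j, h.1⟩
      refine ⟨(Φ j vQ).symm x, ⟨v, hv, hover, ψ, hψ, (ε * δ) • u,
        smul_mem_pBall_of_abs_eq_one p (by rw [abs_mul, hε, hδ, one_mul]) hu, ?_⟩, LinearEquiv.apply_symm_apply _ _⟩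
      rw [hsymm, hx, hδv, map_smul, smul_eq_mul]
      ring
    · rintro ⟨y, ⟨v, hv, hover, ψ, hψ, u, hu, hy⟩, rfl⟩
      obtain ⟨δ, hδ, hδv⟩ := bcoord_starAut hs v ⟨j, h.1⟩
      have hδδ : δ * δ = 1 := mul_self_of_abs_eq_one hδ
      refine ⟨v, hv, hover, (signShells T).starAut Φ v ψ, ⟨ψ, hψ, rfl⟩, (ε * δ) • u,
        smul_mem_pBall_of_abs_eq_one p (by rw [abs_mul, hε, hδ, one_mul]) hu, ?_⟩
      rw [hΦε, hy, hδv, map_smul, smul_eq_mul]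
      linear_combination (-(ε * bcoord v ⟨j, h.1⟩ ψ * coord j vQ u)) * hδδ
  · unfold orbitRegion
    rw [dif_neg h, dif_neg h]
    exact (image_pBall_of_mem_closure p hΦ j vQ 0).symm

variable [hp : Fact p.Prime]

/-- **The operator on data all of whose bad-place coordinates at label `j` are `±q^e`, one of them being `q^e`, is
the cylinder `B_e = q^e·𝒪`** (common computation for the Θ-monoids and the q-datum; w4-d101's
`orbitRegion_eq_pBall_of`, index-generic). [folklore] -/
theorem orbitRegion_eq_pBall_of {j : T.Label} (hj : j ≠ 0) {vQ : T.VQ} (hvQ : HasBad vQ)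
    (Ψ : ∀ v : T.V, v ∈ T.Vbad → Set ((signShells T).StarPacket v)) (e : ℕ)
    (hΨ : ∀ (v : T.V) (hv : v ∈ T.Vbad), T.over v = vQ → ∀ ψ ∈ Ψ v hv,
      bcoord v ⟨j, hj⟩ ψ = (p : ℚ) ^ e ∨ bcoord v ⟨j, hj⟩ ψ = -(p : ℚ) ^ e)
    (hex : ∃ (v : T.V) (hv : v ∈ T.Vbad) (_ : T.over v = vQ), ∃ ψ₀ ∈ Ψ v hv, bcoord v ⟨j, hj⟩ ψ₀ = (p : ℚ) ^ e) :
    orbitRegion p Ψ j vQ = pBall p j vQ e := by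
  rw [orbitRegion_of p _ hj hvQ]
  ext x
  constructor
  · rintro ⟨v, hv, hover, ψ, hψ, u, hu, hx⟩
    show coord j vQ x = 0 ∨ ((e : ℕ) : ℤ) ≤ padicValRat p (coord j vQ x)
    rcases hΨ v hv hover ψ hψ with h1 | h1
    · rw [hx, h1, ← one_mul ((p : ℚ) ^ e)]
      exact (PinnedWitness.mem_pBall_pow_iff p (Or.inl rfl) _ _).2 hu
    · rw [hx, h1, neg_eq_neg_one_mul]
      exact (PinnedWitness.mem_pBall_pow_iff p (Or.inr rfl) _ _).2 hu
  · intro hx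
    obtain ⟨v, hv, hover, ψ₀, hψ₀, hψ₀j⟩ := hex
    have hx' : coord j vQ x = 0 ∨ ((e : ℕ) : ℤ) ≤ padicValRat p (coord j vQ x) := hx
    refine ⟨v, hv, hover, ψ₀, hψ₀, (coord j vQ x / (p : ℚ) ^ e) • onePt j vQ, ?_, ?_⟩
    · show coord j vQ _ = 0 ∨ (0 : ℤ) ≤ padicValRat p (coord j vQ _)
      rw [coord_smul_onePt, ← PinnedWitness.mem_pBall_pow_iff p (Or.inl rfl) e, one_mul, mul_div_cancel₀ _ (PinnedWitness.pow_ne_zero' p _)]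
      exact hx'
    · rw [coord_smul_onePt, hψ₀j, mul_div_cancel₀ _ (PinnedWitness.pow_ne_zero' p _)]

/-- **The operator EVALUATED on the model's splitting monoids `Ψ_v = {(±θ_{v,j})_j}` returns the Kummer image of
the Θ-pilot object**: `B_{j²} = q^{j²}·𝒪` under every bad place (every bad place over `v_ℚ` contributes the same
cylinder: its theta vector has coordinate `q^{j²}` at its own summand), `𝒪` at the zero label and under no bad
place. [folklore] -/
theorem orbitRegion_Psi (j : T.Label) (vQ : T.VQ) :
    orbitRegion p (fun v _ => PsiOf (thetaVec1 p) v) j vQ = pBall p j vQ (tE j vQ) := by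
  classical
  by_cases hj : j = 0
  · subst hj; rw [orbitRegion_zero, tE_zero]
  by_cases hvQ : HasBad vQ
  · rw [tE_of_hasBad hvQ]
    obtain ⟨v, hv, hover⟩ := hvQ
    exact orbitRegion_eq_pBall_of p hj ⟨v, hv, hover⟩ _ ((j : ℕ) ^ 2)
      (fun w hw _ ψ hψ => bcoord_of_mem_PsiOf_thetaVec1 p hψ ⟨j, hj⟩)
      ⟨v, hv, hover, thetaTupleOf (thetaVec1 p) v, thetaTupleOf_mem_PsiOf _ v, bcoord_thetaVec1 p v ⟨j, hj⟩⟩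
  · rw [orbitRegion_of_not_hasBad p _ j hvQ, tE_of_not_hasBad hvQ]

/-! ## D3. The honest Kummer datum of the q-pilot -/

omit hp in
open scoped Classical in
/-- **The `q`-VECTOR of exponent `e`** at the place `v`, label `j`: the pure tensor whose `α = j` factor is the value `q^e`
placed on the summand `v`, the other factors the all-ones vector — the Kummer image in `𝓘^ℚ(^{S^±_{j+1},j};𝒟⊢_v)` of the
element `q_v^e` of the q-pilot's splitting monoid, placed exactly as the theta values are (Part I `thetaVec1` is the case
`e = j²`). [claim: Mochizuki2012, status: disputed] -/
def qVec (e : ℕ) (v : T.V) (j : T.Label) : (signShells T).Packet j (T.over v) :=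
  PiTensorProduct.tprod ℚ fun (i : T.Caps j) (w : T.Fibre (T.over v)) =>
    if i = T.selfIndex j then (if w = T.toFibre v then (p : ℚ) ^ e else 0) else 1

omit hp in
/-- The `q`-vector lies in the SUB-packet at `v`. [folklore] -/
theorem qVec_mem_subPacket (e : ℕ) (v : T.V) (j : T.Label) : qVec p e v j ∈ (signShells T).SubPacket j v := by
  classical
  refine Submodule.subset_span ⟨_, fun w hw => ?_, rfl⟩
  have hne : w ≠ T.toFibre v := fun h => hw (by rw [h]; rfl)
  simp [hne]

omit hp in
/-- **The coordinate AT `v` of the `q`-vector of exponent `e` is EXACTLY `q^e`.** [folklore] -/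
theorem coordAt_qVec (e : ℕ) (v : T.V) (j : T.Label) :
    coordAt j (T.over v) (T.toFibre v) (qVec p e v j) = (p : ℚ) ^ e := by
  classical
  unfold qVec
  rw [coordAt_tprod]
  rw [Finset.prod_eq_single (T.selfIndex j)]
  · simp
  · intro i _ hi
    simp [hi]
  · intro h
    exact absurd (Finset.mem_univ _) h

omit hp in
/-- **The bad-place Kummer datum of a q-pilot datum** `Q` (the q-side input `qK` of w5-d230's `QPinned`, COMPUTED from
`Q`, not free; w4-d101's `kummerOfExp`, index-generic): at each bad place `v` the sign-translates `(±q^e_{v,j})_{j ∈ 𝔽_l^⋆}`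
of the tuple of `q`-vectors, `e :=` the exponent read off `Q.q v` (labels identified by "△", [IUTchII] Cor. 4.10 (i)).
[claim: Mochizuki2012, status: disputed] -/
def kummerOfExp (Q : QPilotData ℤ (fun (v : T.V) (_ : v ∈ T.Vbad) => PinnedWitness.ExpMonoid)) :
    ∀ v : T.V, v ∈ T.Vbad → Set ((signShells T).StarPacket v) := fun v hv =>
  {ψ | ∀ j : T.LabelStar,
    ψ j = qVec p (PinnedWitness.expOf (Q.q v hv)) v j.1 ∨ ψ j = -qVec p (PinnedWitness.expOf (Q.q v hv)) v j.1}

variable (v₁ : T.V) (hv₁ : v₁ ∈ T.Vbad) (c : ℝ)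

omit hp in
/-- `qDatum :=` the Kummer datum of THE SETTING'S OWN q-pilot datum (`q_v = gen`, exponent `1`): the sign-translates
`(±q_{v,j})_j` of the tuple of `q`-vectors of exponent `1`. [claim: Mochizuki2012, status: disputed] -/
def qDatum : ∀ v : T.V, v ∈ T.Vbad → Set ((signShells T).StarPacket v) :=
  kummerOfExp p (pinnedSetting p v₁ hv₁ c).qData

omit hp in
/-- The exponent read off the setting's q-pilot datum is `1` at every bad place. [folklore] -/
theorem expOf_qData (v : T.V) (hv : v ∈ T.Vbad) :
    PinnedWitness.expOf ((pinnedSetting p v₁ hv₁ c).qData.q v hv) = 1 := rfl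

omit hp in
/-- `qDatum` at a bad place, unfolded: the sign-translates of the tuple of `q`-vectors of exponent `1`. [folklore] -/
theorem mem_qDatum_iff (v : T.V) (hv : v ∈ T.Vbad) (ψ : (signShells T).StarPacket v) :
    ψ ∈ qDatum p v₁ hv₁ c v hv ↔ ∀ j : T.LabelStar, ψ j = qVec p 1 v j.1 ∨ ψ j = -qVec p 1 v j.1 :=
  Iff.rfl

omit hp in
/-- The tuple of `q`-vectors `(q_{v,j})_j` lies in `qDatum` at every bad place (which is therefore nonempty). [folklore] -/
theorem qTuple_mem_qDatum (v : T.V) (hv : v ∈ T.Vbad) :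
    (fun j : T.LabelStar => qVec p 1 v j.1) ∈ qDatum p v₁ hv₁ c v hv := fun _ => Or.inl rfl

omit hp in
/-- The bad-place coordinates of the elements of `qDatum` are `±q`. [folklore] -/
theorem bcoord_of_mem_qDatum {v : T.V} {hv : v ∈ T.Vbad} {ψ : (signShells T).StarPacket v}
    (hψ : ψ ∈ qDatum p v₁ hv₁ c v hv) (j : T.LabelStar) :
    bcoord v j ψ = (p : ℚ) ^ (1 : ℕ) ∨ bcoord v j ψ = -(p : ℚ) ^ (1 : ℕ) := by
  unfold bcoord
  rcases (mem_qDatum_iff p v₁ hv₁ c v hv ψ).1 hψ j with h | h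
  · exact Or.inl (by rw [h, coordAt_qVec])
  · exact Or.inr (by rw [h, map_neg, coordAt_qVec])

omit hp in
/-- `qDatum` sits in the product of the SUB-packets at every bad place (as a Kummer image at `v` should). [folklore] -/
theorem qDatum_subPacket {v : T.V} {hv : v ∈ T.Vbad} {ψ : (signShells T).StarPacket v}
    (hψ : ψ ∈ qDatum p v₁ hv₁ c v hv) (j : T.LabelStar) : ψ j ∈ (signShells T).SubPacket j.1 v := by
  rcases (mem_qDatum_iff p v₁ hv₁ c v hv ψ).1 hψ j with h | h
  · rw [h]; exact qVec_mem_subPacket p 1 v j.1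
  · rw [h]; exact Submodule.neg_mem _ (qVec_mem_subPacket p 1 v j.1)

/-- **The operator EVALUATED on the q-pilot's Kummer datum returns the image of the q-pilot object**: `B_1 = q·𝒪`
at the labels of `𝔽_l^⋆` under every bad place, `𝒪` elsewhere. [folklore] -/
theorem orbitRegion_qDatum (j : T.Label) (vQ : T.VQ) :
    orbitRegion p (qDatum p v₁ hv₁ c) j vQ = pBall p j vQ (qE j vQ) := by
  classical
  by_cases hj : j = 0
  · subst hj; rw [orbitRegion_zero, qE_zero]
  by_cases hvQ : HasBad vQ
  · rw [qE_of_hasBad hvQ hj]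
    obtain ⟨v, hv, hover⟩ := hvQ
    have h := orbitRegion_eq_pBall_of p hj ⟨v, hv, hover⟩ (qDatum p v₁ hv₁ c) 1
      (fun w hw _ ψ hψ => bcoord_of_mem_qDatum p v₁ hv₁ c hψ ⟨j, hj⟩)
      ⟨v, hv, hover, _, qTuple_mem_qDatum p v₁ hv₁ c v hv, coordAt_qVec p 1 v j⟩
    rw [h]; rfl
  · rw [orbitRegion_of_not_hasBad p _ j hvQ, qE_of_not_hasBad hvQ]

/-! ## D4. The three pins HOLD -/

/-- **(hρ) ∧ (pΘ) — the Θ-pilot pin HOLDS** for the operator `orbitRegion`: equivariance under ⟨(Ind1) ∪ (Ind2)⟩, and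
at EVERY lattice position `m`, label `j` and rational place `v_ℚ` the Kummer image of the Θ-pilot object IS the region
of the column-`m` Kummer image `frobΨ m` of the Frobenius-like splitting monoids (which is `Ψ` again, Part II
`full1_frobΨ`). [claim: Mochizuki2012, status: disputed] -/
theorem pinnedSetting_thetaPinned :
    ThetaPinned (full1 p (T.over v₁) c).toLatticeSituation (pinnedSetting p v₁ hv₁ c) (orbitRegion p) := by
  refine ⟨fun Φ hΦ Ψ j vQ => orbitRegion_equivariant p hΦ Ψ j vQ, fun m j vQ => ?_⟩
  have hΨ : ((full1 p (T.over v₁) c).col (pinnedSetting p v₁ hv₁ c).n).frobΨ m = fun v _ => PsiOf (thetaVec1 p) v :=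
    full1_frobΨ p (T.over v₁) c _ m
  rw [hΨ, orbitRegion_Psi, pinnedSetting_thetaRegion]

/-- **(pq′) — the q-pilot pin HOLDS** for the SAME operator and the q-pilot's own Kummer datum `qDatum` (computed from
`qData.q`): both sides are `B_1 = q·𝒪` at the labels of `𝔽_l^⋆` under a bad place and `𝒪` elsewhere.
[claim: Mochizuki2012, status: disputed] -/
theorem pinnedSetting_qPinned :
    QPinned (full1 p (T.over v₁) c).toLatticeSituation (pinnedSetting p v₁ hv₁ c) (orbitRegion p)
      (qDatum p v₁ hv₁ c) := fun j vQ => by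
  rw [pinnedSetting_qRegion, orbitRegion_qDatum]

/-- **`PinnedRegions` HOLDS** at the pinned model over the index skeleton (abc-iut-w5-d230's PR-1 predicate, p417551).
[claim: Mochizuki2012, status: disputed] -/
theorem pinnedSetting_pinnedRegions :
    PinnedRegions (full1 p (T.over v₁) c).toLatticeSituation (pinnedSetting p v₁ hv₁ c) (orbitRegion p)
      (qDatum p v₁ hv₁ c) :=
  ⟨pinnedSetting_thetaPinned p v₁ hv₁ c, pinnedSetting_qPinned p v₁ hv₁ c⟩

/-- **The third pin (pL) holds too: `PinnedRegions3`** (p418935; (pL) = c312-1's object-level `PilotLink`, Part III's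
contentful `pinnedSetting_pilotLink`). [claim: Mochizuki2012, status: disputed] -/
theorem pinnedSetting_pinnedRegions3 :
    PinnedRegions3 (full1 p (T.over v₁) c).toLatticeSituation (pinnedSetting p v₁ hv₁ c) (orbitRegion p)
      (qDatum p v₁ hv₁ c) :=
  ⟨pinnedSetting_pinnedRegions p v₁ hv₁ c, pinnedSetting_pilotLink p v₁ hv₁ c⟩

/-- The operator is NOT constant on the data that matter: at the label `l⋆` under the bad place `v₁` it separates `∅`
from the column's splitting monoids. [folklore] -/
theorem orbitRegion_separates :
    ∃ (j : T.Label) (vQ : T.VQ), orbitRegion p (fun _ _ => ∅) j vQ ≠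
      orbitRegion p ((full1 p (T.over v₁) c).D (pinnedSetting p v₁ hv₁ c).n).Ψ j vQ := by
  have hl : (Fin.last T.lstar : T.Label) ≠ 0 := fun h0 => by
    have hl := T.two_le_lstar
    have := congrArg Fin.val h0
    simp at this
    omega
  refine ⟨Fin.last T.lstar, T.over v₁, ?_⟩
  have hΨ : ((full1 p (T.over v₁) c).D (pinnedSetting p v₁ hv₁ c).n).Ψ = fun v _ => PsiOf (thetaVec1 p) v := rfl
  rw [orbitRegion_empty p hl (hasBad_over v₁ hv₁), hΨ, orbitRegion_Psi]
  exact fun h => (Set.nonempty_iff_ne_empty.1 ⟨0, zero_mem_pBall p _ (T.over v₁) _⟩) h.symm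

omit hp in
/-- The q-pilot's Kummer datum is nonempty at every bad place. [folklore] -/
theorem qDatum_nonempty (v : T.V) (hv : v ∈ T.Vbad) : (qDatum p v₁ hv₁ c v hv).Nonempty :=
  ⟨_, qTuple_mem_qDatum p v₁ hv₁ c v hv⟩

end NaiveProv

end Cor312Vol

end IUTFork

end Summit.ABC

end
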